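import Summits.Ventures.WeilGRH.TwistedOddComplexTail
import HarnessLib

/-!
# GRH arm (rh-explicit, venture WeilGRH): the SHARP `sech` sine moment on whole periods and the ROW-WEIGHTED tail of
  the parity-1 `sech` columns

Cell `rh-explicit`, WEIL TRACK — GRH ARM (lit/typing seat weil-grh-5 gen12).  Sequel of `TwistedOddComplexTail.lean`
(isotropic tail `c_S = (2B−1)·2(a(1+1/B₃)/π²)²/((B₃−B)d₀)` of the bonus columns
`|πδ_{nm} − sechIncrCoeff a n m| = |I_m − I_n|/(π|n − m|)`, `I_p = ∫_{(0,2a]} σ sin(πpt/a)`, `σ(t) = 1/(2cosh(t/2))`).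
Two elementary sharpenings, used by the door `TwistedOddComplexDataRungJrw.lean`:

* WHOLE PERIODS: `(0, 2a]` carries `|p|` whole periods of `sin(πpt/a)`, so in the integration by parts of
  `abs_integral_sech_mul_sin_le` (`TwistedSechSinIntegral.lean`) the boundary terms cancel to `(σ(0) − σ(2a))/ω` —
  `abs_integral_sech_mul_sin_le_of_cos_eq_one`, `abs_sechSinMoment_le_div_sharp`: `|p|·|I_p| ≤ a(1 − 1/cosh a)/π`
  (factor `0.352` at `a = 1`, `0.075` at `a = 2/5`) instead of `a/π`;
* ROW WEIGHTS: the moment bound is used for the block mode `n` as well (`I_0 = 0`):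
  `abs_sechBonus_signed_far_le_rw` — `|πδ_{nm} − sechIncrCoeff a n m| ≤ (a(1 − 1/cosh a)/π²)(1/B₃ + [n≠0]/|n|)/(|m| − B + 1)`
  for `|n| < B ≤ B₃/2 ≤ |m|/2`; Cauchy–Schwarz over the block (`rowWeight_iota` translates the weight to the enumeration)
  gives `sechBonus_tail_rw_enum` — `Σ_{j ≥ 2B₃−1}(Σ_i Π(ι i, ι j)x_i)²/W((j+1)/2) ≤ c_S^{rw}‖x‖²` (`W ≥ d₀ > 0` beyond `B₃`),
  `c_S^{rw} = R_B·2(a(1 − 1/cosh a)/π²)²/((B₃−B)d₀)`, `R_B = Σ_{k<2B−1}(1/B₃ + [k≠0]/((k+1)/2))² = 1/B₃² + 2Σ_{1≤n<B}(1/B₃ + 1/n)²`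
  (`R_B ≤ π²/3 + 4H_{B−1}/B₃ + (2B−1)/B₃² ≈ 3.3` against the isotropic factor `(2B−1)(1+1/B₃)² ≈ 2B`; at `a = 1`,
  `(B, B₃) = (48, 2048)`: `c_S^{rw} = c_S/236`).

No definitions; no named facts; RH/GRH-free; standard axioms.
-/

set_option autoImplicit false

noncomputable section

open Complex Finset MeasureTheory Set
open scoped Real BigOperators ComplexConjugate

namespace Summit.Ventures.WeilGRH

open Literature.NumberTheory.LFunctions
open Summit.RiemannHypothesis.RiemannHypothesis.Theorems.WeilFormatC

variable {a : ℝ}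

/-! ## 0. The sharp `sech` sine moment on whole periods: `|p|·|I_p| ≤ a(1 − 1/cosh a)/π` -/

section Moment

/-- **`|∫₀^T σ(t) sin(ωt) dt| ≤ (1 − 1/cosh(T/2))/ω`** for `ω > 0`, `T ≥ 0` and `cos(ωT) = 1` (whole periods),
`σ(t) = 1/(2cosh(t/2))`: the same integration by parts as `abs_integral_sech_mul_sin_le` (`|…| ≤ 1/ω`), but on whole
periods the two boundary terms CANCEL to `(σ(0) − σ(T))/ω` instead of adding up to `(σ(0) + σ(T))/ω`. -/
theorem abs_integral_sech_mul_sin_le_of_cos_eq_one {ω T : ℝ} (hω : 0 < ω) (hT : 0 ≤ T)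
    (hcos : Real.cos (ω * T) = 1) :
    |∫ t in (0 : ℝ)..T, 1 / (2 * Real.cosh (t / 2)) * Real.sin (ω * t)| ≤ (1 - 1 / Real.cosh (T / 2)) / ω := by
  set σ : ℝ → ℝ := fun t ↦ 1 / (2 * Real.cosh (t / 2)) with hσ
  set σ' : ℝ → ℝ := fun t ↦ -Real.sinh (t / 2) / (4 * Real.cosh (t / 2) ^ 2) with hσ'
  set v : ℝ → ℝ := fun t ↦ -Real.cos (ω * t) / ω with hv
  have hωne : ω ≠ 0 := hω.ne'
  have hdv : ∀ t, HasDerivAt v (Real.sin (ω * t)) t := fun t ↦ by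
    have h := (((hasDerivAt_id' t).const_mul ω).cos).const_mul (-1 / ω)
    have hfun : v = fun x : ℝ ↦ -1 / ω * Real.cos (ω * x) := by
      funext x; simp only [hv]; ring
    rw [hfun]
    refine h.congr_deriv ?_
    field_simp
  have hparts := intervalIntegral.integral_mul_deriv_eq_deriv_mul (a := 0) (b := T) (u := σ) (v := v) (u' := σ')
    (v' := fun t ↦ Real.sin (ω * t)) (fun t _ ↦ hasDerivAt_sech_density t) (fun t _ ↦ hdv t)
    (continuous_deriv_sech_density.intervalIntegrable _ _)
    ((Real.continuous_sin.comp (continuous_const.mul continuous_id)).intervalIntegrable _ _)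
  rw [hparts]
  have hσ0 : σ 0 = 1 / 2 := by simp [hσ]
  have hσle : σ T ≤ σ 0 := by
    rw [hσ0]
    simp only [hσ]
    exact div_le_div_of_nonneg_left (by norm_num) (by norm_num) (by linarith [Real.one_le_cosh (T / 2)])
  have hvb : ∀ t, |v t| ≤ 1 / ω := fun t ↦ by
    simp only [hv, abs_div, abs_neg, abs_of_pos hω]
    exact div_le_div_of_nonneg_right (Real.abs_cos_le_one _) hω.le
  -- boundary terms on whole periods: `σ(T)v(T) − σ(0)v(0) = (σ 0 − σ T)/ω`
  have hv0 : v 0 = -1 / ω := by simp only [hv, mul_zero, Real.cos_zero]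
  have hvT : v T = -1 / ω := by simp only [hv]; rw [hcos]
  have hbd : σ T * v T - σ 0 * v 0 = (σ 0 - σ T) / ω := by rw [hvT, hv0]; ring
  -- bulk term: `|∫ σ' v| ≤ ∫ (−σ')/ω = (σ 0 − σ T)/ω`
  have hbulk : |∫ t in (0 : ℝ)..T, σ' t * v t| ≤ (σ 0 - σ T) / ω := by
    have hle : |∫ t in (0 : ℝ)..T, σ' t * v t| ≤ ∫ t in (0 : ℝ)..T, -σ' t / ω := by
      rw [← Real.norm_eq_abs]
      refine intervalIntegral.norm_integral_le_of_norm_le hT (Filter.Eventually.of_forall fun t ht ↦ ?_)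
        ((continuous_deriv_sech_density.neg.div_const ω).intervalIntegrable _ _)
      have hneg : σ' t ≤ 0 := by
        simp only [hσ']
        exact div_nonpos_of_nonpos_of_nonneg (neg_nonpos.mpr (Real.sinh_nonneg_iff.mpr (by linarith [ht.1])))
          (by positivity)
      rw [Real.norm_eq_abs, abs_mul, abs_of_nonpos hneg]
      refine (mul_le_mul_of_nonneg_left (hvb t) (neg_nonneg.mpr hneg)).trans_eq ?_
      ring
    have hint : ∫ t in (0 : ℝ)..T, -σ' t / ω = (σ 0 - σ T) / ω := by
      have h := intervalIntegral.integral_eq_sub_of_hasDerivAt (a := 0) (b := T) (f := fun t ↦ -σ t / ω)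
        (f' := fun t ↦ -σ' t / ω) (fun t _ ↦ ((hasDerivAt_sech_density t).neg).div_const ω)
        ((continuous_deriv_sech_density.neg.div_const ω).intervalIntegrable _ _)
      rw [h]
      ring
    exact hle.trans hint.le
  rw [hbd]
  have hnn : 0 ≤ (σ 0 - σ T) / ω := div_nonneg (sub_nonneg.mpr hσle) hω.le
  calc |(σ 0 - σ T) / ω - ∫ t in (0 : ℝ)..T, σ' t * v t|
      ≤ |(σ 0 - σ T) / ω| + |∫ t in (0 : ℝ)..T, σ' t * v t| := abs_sub _ _
    _ ≤ (σ 0 - σ T) / ω + (σ 0 - σ T) / ω := add_le_add (abs_of_nonneg hnn).le hbulk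
    _ = (1 - 1 / Real.cosh (T / 2)) / ω := by
        rw [hσ0]
        simp only [hσ]
        field_simp
        ring

/-- `0 ≤ 1 − 1/cosh a`. -/
theorem one_sub_inv_cosh_nonneg (a : ℝ) : 0 ≤ 1 - 1 / Real.cosh a := by
  rw [sub_nonneg, div_le_one (Real.cosh_pos a)]
  exact Real.one_le_cosh a

/-- **Sharp `sech` sine moments of Yoshida's window** (whole periods): for `a > 0`, `p ≠ 0`,
`|∫_{(0,2a]} σ(t) sin(πpt/a) dt| ≤ a(1 − 1/cosh a)/(π|p|)` — against `a/(π|p|)` in `abs_setIntegral_sech_mul_sin_freq_le`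
(factor `1 − 1/cosh a = 0.352…` at `a = 1`, `0.075…` at `a = 2/5`). -/
theorem abs_sechSinMoment_le_div_sharp (ha : 0 < a) {p : ℤ} (hp : p ≠ 0) :
    |∫ t in Ioc 0 (2 * a), 1 / (2 * Real.cosh (t / 2)) * Real.sin (π * p / a * t)|
      ≤ a * (1 - 1 / Real.cosh a) / (π * |(p : ℝ)|) := by
  -- positive frequencies first
  have key : ∀ m : ℤ, 0 < m →
      |∫ t in Ioc 0 (2 * a), 1 / (2 * Real.cosh (t / 2)) * Real.sin (π * m / a * t)|
        ≤ a * (1 - 1 / Real.cosh a) / (π * |(m : ℝ)|) := by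
    intro m hm
    have hT : (0 : ℝ) ≤ 2 * a := by positivity
    have hmR : (0 : ℝ) < (m : ℝ) := by exact_mod_cast hm
    have hω : 0 < π * (m : ℝ) / a := by positivity
    have hcos : Real.cos (π * (m : ℝ) / a * (2 * a)) = 1 := by
      rw [show π * (m : ℝ) / a * (2 * a) = (m : ℝ) * (2 * π) by field_simp]
      exact Real.cos_int_mul_two_pi m
    rw [← intervalIntegral.integral_of_le hT]
    refine (abs_integral_sech_mul_sin_le_of_cos_eq_one hω hT hcos).trans (le_of_eq ?_)
    rw [abs_of_pos hmR, show 2 * a / 2 = a by ring]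
    field_simp
  rcases lt_or_gt_of_ne hp with hneg | hpos
  · have h := key (-p) (by omega)
    rw [sechSinMoment_neg, abs_neg] at h
    refine h.trans (le_of_eq ?_)
    rw [Int.cast_neg, abs_neg]
  · exact key p hpos

end Moment

/-! ## 1. The row-weighted bound of the far `sech` columns on signed modes -/

section Bonus

/-- **Row-weighted decay of the bonus column**: for `|n| < B`, `B₃ ≤ |m|`, `2B ≤ B₃`,
`|πδ_{nm} − sechIncrCoeff a n m| ≤ (a(1 − 1/cosh a)/π²)(1/B₃ + [n ≠ 0]/|n|)/(|m| − B + 1)` — from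
`|Π(n,m)| ≤ (|I_m| + |I_n|)/(π|n − m|)`, the SHARP moment `|p|·|I_p| ≤ a(1 − 1/cosh a)/π` for BOTH `p = m` and `p = n`,
and `I_0 = 0` (the isotropic `abs_sechBonus_signed_far_le` used `|m|·|I_m| ≤ a/π` and `|I_n| ≤ a/π`). -/
theorem abs_sechBonus_signed_far_le_rw (ha : 0 < a) {B B₃ : ℕ} (hB : 1 ≤ B) (hBB : 2 * B ≤ B₃) {n m : ℤ}
    (hn : n.natAbs < B) (hm : B₃ ≤ m.natAbs) :
    |(if n = m then π else 0) - sechIncrCoeff a n m|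
      ≤ a * (1 - 1 / Real.cosh a) / π ^ 2 * (1 / (B₃ : ℝ) + (if n = 0 then 0 else 1 / (n.natAbs : ℝ)))
        / ((m.natAbs - B + 1 : ℕ) : ℝ) := by
  set c : ℝ := 1 - 1 / Real.cosh a with hc_def
  have hc0 : 0 ≤ c := one_sub_inv_cosh_nonneg a
  have hac : 0 ≤ a * c := mul_nonneg ha.le hc0
  have hnm : n ≠ m := by rintro rfl; omega
  have hm0 : m ≠ 0 := by rintro rfl; simp at hm; omega
  have hB₃pos : (0 : ℝ) < B₃ := by exact_mod_cast (show 0 < B₃ by omega)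
  have hmR : (B₃ : ℝ) ≤ |(m : ℝ)| := by
    rw [← Int.cast_abs, Int.abs_eq_natAbs]; exact_mod_cast hm
  have hnR : |(n : ℝ)| ≤ ((B - 1 : ℕ) : ℝ) := by
    rw [← Int.cast_abs, Int.abs_eq_natAbs]; exact_mod_cast (show n.natAbs ≤ B - 1 by omega)
  -- the denominator
  have hden : ((m.natAbs - B + 1 : ℕ) : ℝ) ≤ |(n : ℝ) - m| := by
    have h1 : ((m.natAbs - B + 1 : ℕ) : ℝ) = (m.natAbs : ℝ) - B + 1 := by
      rw [Nat.cast_add, Nat.cast_sub (by omega), Nat.cast_one]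
    have h2 : (m.natAbs : ℝ) = |(m : ℝ)| := by
      rw [← Int.cast_abs, Int.abs_eq_natAbs, Int.cast_natCast]
    have h3 : ((B - 1 : ℕ) : ℝ) = (B : ℝ) - 1 := by rw [Nat.cast_sub hB, Nat.cast_one]
    rw [h1, h2]
    have h4 : |(m : ℝ)| - |(n : ℝ)| ≤ |(n : ℝ) - m| := by
      rw [abs_sub_comm]; exact abs_sub_abs_le_abs_sub _ _
    linarith
  have hdenpos : (0 : ℝ) < ((m.natAbs - B + 1 : ℕ) : ℝ) := by exact_mod_cast (show 0 < m.natAbs - B + 1 by omega)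
  -- the numerator, row-weighted
  have hIm := abs_sechSinMoment_le_div_sharp ha hm0
  have hρ0 : 0 ≤ (if n = 0 then (0 : ℝ) else 1 / (n.natAbs : ℝ)) := by
    split_ifs <;> positivity
  have hnum : |∫ t in Ioc 0 (2 * a), 1 / (2 * Real.cosh (t / 2)) * Real.sin (π * m / a * t)|
        + |∫ t in Ioc 0 (2 * a), 1 / (2 * Real.cosh (t / 2)) * Real.sin (π * n / a * t)|
      ≤ a * c / π * (1 / (B₃ : ℝ) + (if n = 0 then 0 else 1 / (n.natAbs : ℝ))) := by
    have h1 : a * c / (π * |(m : ℝ)|) ≤ a * c / π * (1 / (B₃ : ℝ)) := by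
      rw [show a * c / π * (1 / (B₃ : ℝ)) = a * c / (π * B₃) by field_simp]
      apply div_le_div_of_nonneg_left hac (by positivity)
      exact mul_le_mul_of_nonneg_left hmR Real.pi_pos.le
    have h2 : |∫ t in Ioc 0 (2 * a), 1 / (2 * Real.cosh (t / 2)) * Real.sin (π * n / a * t)|
        ≤ a * c / π * (if n = 0 then 0 else 1 / (n.natAbs : ℝ)) := by
      by_cases hn0 : n = 0
      · subst hn0
        have h0 := sechSinMoment_zero a
        rw [h0, abs_zero, if_pos rfl, mul_zero]
      · rw [if_neg hn0]
        have h := abs_sechSinMoment_le_div_sharp ha hn0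
        have e : (n.natAbs : ℝ) = |(n : ℝ)| := by
          rw [← Int.cast_abs, Int.abs_eq_natAbs, Int.cast_natCast]
        rw [e, show a * c / π * (1 / |(n : ℝ)|) = a * c / (π * |(n : ℝ)|) by field_simp]
        exact h
    calc _ ≤ a * c / π * (1 / (B₃ : ℝ)) + a * c / π * (if n = 0 then 0 else 1 / (n.natAbs : ℝ)) :=
          add_le_add (hIm.trans h1) h2
      _ = _ := by ring
  have hnum0 : 0 ≤ a * c / π * (1 / (B₃ : ℝ) + (if n = 0 then 0 else 1 / (n.natAbs : ℝ))) :=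
    mul_nonneg (div_nonneg hac Real.pi_pos.le) (add_nonneg (by positivity) hρ0)
  calc |(if n = m then π else 0) - sechIncrCoeff a n m|
      ≤ _ := abs_sechBonus_offDiag_le a hnm
    _ ≤ (a * c / π * (1 / (B₃ : ℝ) + (if n = 0 then 0 else 1 / (n.natAbs : ℝ)))) / (π * ((m.natAbs - B + 1 : ℕ) : ℝ)) := by
        have hπd : 0 < π * ((m.natAbs - B + 1 : ℕ) : ℝ) := by positivity
        calc _ ≤ (a * c / π * (1 / (B₃ : ℝ) + (if n = 0 then 0 else 1 / (n.natAbs : ℝ)))) / (π * |(n : ℝ) - m|) :=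
              div_le_div_of_nonneg_right hnum (by positivity)
          _ ≤ _ := div_le_div_of_nonneg_left hnum0 hπd
                (mul_le_mul_of_nonneg_left hden Real.pi_pos.le)
    _ = a * c / π ^ 2 * (1 / (B₃ : ℝ) + (if n = 0 then 0 else 1 / (n.natAbs : ℝ))) / ((m.natAbs - B + 1 : ℕ) : ℝ) := by
        field_simp

/-- `ι i = 0 ↔ i = 0` on the enumeration, in the form of the row weight:
`[ι i ≠ 0]/|ι i| = [i ≠ 0]/((i+1)/2)`. -/
theorem rowWeight_iota (i : ℕ) :
    (if (if i % 2 = 1 then (((i + 1) / 2 : ℕ) : ℤ) else -((i / 2 : ℕ) : ℤ)) = 0 then (0 : ℝ)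
      else 1 / (((if i % 2 = 1 then (((i + 1) / 2 : ℕ) : ℤ) else -((i / 2 : ℕ) : ℤ)).natAbs : ℝ)))
      = (if i = 0 then (0 : ℝ) else 1 / ((((i + 1) / 2 : ℕ)) : ℝ)) := by
  have hz : ((if i % 2 = 1 then (((i + 1) / 2 : ℕ) : ℤ) else -((i / 2 : ℕ) : ℤ)) = 0) ↔ i = 0 := by
    rw [← Int.natAbs_eq_zero, natAbs_iota]; omega
  rw [natAbs_iota]
  by_cases hi : i = 0
  · rw [if_pos (hz.mpr hi), if_pos hi]
  · rw [if_neg (fun h ↦ hi (hz.mp h)), if_neg hi]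

/-- **Row-weighted tail of the bonus columns on the enumeration** (sharper sequel of `sechBonus_tail_isotropic_enum`):
with `ι` the inverse enumeration, `W ≥ d₀ > 0` beyond `B₃ ≥ 2B`, for every `N'` and every real block vector `x`,
`Σ_{j ∈ Ico (2B₃−1) N'} (Σ_i Π(ι i, ι j) x_i)²/W((j+1)/2) ≤ c_S^{rw}·‖x‖²`,
`c_S^{rw} = R_B · 2(a(1 − 1/cosh a)/π²)²/((B₃ − B)·d₀)`,
`R_B = Σ_{i < 2B−1} (1/B₃ + [i ≠ 0]/((i+1)/2))² = 1/B₃² + 2Σ_{1 ≤ k < B}(1/B₃ + 1/k)²`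
(Cauchy–Schwarz over the block with the row-weighted entry bound, both signs of `m`, `Σ 1/(m−B+1)² ≤ 1/(B₃−B)`).
`R_B(1 − 1/cosh a)²` (`R_B ≤ π²/3 + 4H_{B−1}/B₃ + (2B−1)/B₃² ≈ 3.3`) replaces the isotropic factor `(2B−1)(1+1/B₃)²`. -/
theorem sechBonus_tail_rw_enum (ha : 0 < a) {B B₃ : ℕ} (hB : 1 ≤ B) (hBB : 2 * B ≤ B₃)
    (W : ℕ → ℝ) {d₀ : ℝ} (hd₀ : 0 < d₀) (hd : ∀ m, B₃ ≤ m → d₀ ≤ W m) (N' : ℕ) (x : Fin (2 * B - 1) → ℝ) :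
    ∑ j ∈ Finset.Ico (2 * B₃ - 1) N', (∑ i : Fin (2 * B - 1),
        ((ite ((if (i : ℕ) % 2 = 1 then ((((i : ℕ) + 1) / 2 : ℕ) : ℤ) else -((((i : ℕ) / 2 : ℕ) : ℤ))) = (if j % 2 = 1 then (((j + 1) / 2 : ℕ) : ℤ) else -((j / 2 : ℕ) : ℤ))) π 0) - sechIncrCoeff a (if (i : ℕ) % 2 = 1 then ((((i : ℕ) + 1) / 2 : ℕ) : ℤ) else -((((i : ℕ) / 2 : ℕ) : ℤ))) (if j % 2 = 1 then (((j + 1) / 2 : ℕ) : ℤ) else -((j / 2 : ℕ) : ℤ))) * x i) ^ 2 / W ((j + 1) / 2)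
      ≤ ((∑ k : Fin (2 * B - 1), (1 / (B₃ : ℝ) + (if (k : ℕ) = 0 then 0 else 1 / ((((k : ℕ) + 1) / 2 : ℕ) : ℝ))) ^ 2)
            * (2 * (a * (1 - 1 / Real.cosh a) / π ^ 2) ^ 2 / (((B₃ - B : ℕ) : ℝ) * d₀)))
          * ∑ i : Fin (2 * B - 1), x i ^ 2 := by
  have hB₃1 : 1 ≤ B₃ := by omega
  set c : ℝ := 1 - 1 / Real.cosh a with hc_def
  set σ : ℕ → ℝ := fun m ↦ a * c / π ^ 2 / ((m - B + 1 : ℕ) : ℝ) with hσ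
  set R : ℝ := ∑ k : Fin (2 * B - 1), (1 / (B₃ : ℝ) + (if (k : ℕ) = 0 then 0 else 1 / ((((k : ℕ) + 1) / 2 : ℕ) : ℝ))) ^ 2
    with hR
  set X : ℝ := ∑ i : Fin (2 * B - 1), x i ^ 2 with hX
  have hX0 : 0 ≤ X := Finset.sum_nonneg fun i _ ↦ sq_nonneg _
  have hR0 : 0 ≤ R := Finset.sum_nonneg fun i _ ↦ sq_nonneg _
  -- termwise bound
  have hterm : ∀ j, 2 * B₃ - 1 ≤ j →
      (∑ i : Fin (2 * B - 1), ((ite ((if (i : ℕ) % 2 = 1 then ((((i : ℕ) + 1) / 2 : ℕ) : ℤ) else -((((i : ℕ) / 2 : ℕ) : ℤ))) = (if j % 2 = 1 then (((j + 1) / 2 : ℕ) : ℤ) else -((j / 2 : ℕ) : ℤ))) π 0) - sechIncrCoeff a (if (i : ℕ) % 2 = 1 then ((((i : ℕ) + 1) / 2 : ℕ) : ℤ) else -((((i : ℕ) / 2 : ℕ) : ℤ))) (if j % 2 = 1 then (((j + 1) / 2 : ℕ) : ℤ) else -((j / 2 : ℕ) : ℤ))) * x i) ^ 2 / W ((j +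 1) / 2)
        ≤ R * σ ((j + 1) / 2) ^ 2 * X / d₀ := by
    intro j hj
    have hmj : B₃ ≤ (j + 1) / 2 := by omega
    have hWj : d₀ ≤ W ((j + 1) / 2) := hd _ hmj
    have hWpos : 0 < W ((j + 1) / 2) := hd₀.trans_le hWj
    have hcs := Finset.sum_mul_sq_le_sq_mul_sq (Finset.univ : Finset (Fin (2 * B - 1)))
      (fun i : Fin (2 * B - 1) ↦ ((ite ((if (i : ℕ) % 2 = 1 then ((((i : ℕ) + 1) / 2 : ℕ) : ℤ) else -((((i : ℕ) / 2 : ℕ) : ℤ))) = (if j % 2 = 1 then (((j + 1) / 2 : ℕ) : ℤ) else -((j / 2 : ℕ) : ℤ))) π 0) - sechIncrCoeff a (if (i : ℕ) % 2 = 1 then ((((i : ℕ) + 1) / 2 : ℕ) : ℤ) else -((((i : ℕ) / 2 : ℕ) : ℤ))) (if j % 2 = 1 then (((j + 1) / 2 : ℕ) : ℤ) else -((j / 2 : ℕ) : ℤ)))) x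
    have hentry : ∀ i : Fin (2 * B - 1), ((ite ((if (i : ℕ) % 2 = 1 then ((((i : ℕ) + 1) / 2 : ℕ) : ℤ) else -((((i : ℕ) / 2 : ℕ) : ℤ))) = (if j % 2 = 1 then (((j + 1) / 2 : ℕ) : ℤ) else -((j / 2 : ℕ) : ℤ))) π 0) - sechIncrCoeff a (if (i : ℕ) % 2 = 1 then ((((i : ℕ) + 1) / 2 : ℕ) : ℤ) else -((((i : ℕ) / 2 : ℕ) : ℤ))) (if j % 2 = 1 then (((j + 1) / 2 : ℕ) : ℤ) else -((j / 2 : ℕ) : ℤ))) ^ 2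
        ≤ (1 / (B₃ : ℝ) + (if ((i : ℕ)) = 0 then 0 else 1 / (((((i : ℕ)) + 1) / 2 : ℕ) : ℝ))) ^ 2 * σ ((j + 1) / 2) ^ 2 := by
      intro i
      have hi : (if (i : ℕ) % 2 = 1 then ((((i : ℕ) + 1) / 2 : ℕ) : ℤ) else -((((i : ℕ) / 2 : ℕ) : ℤ))).natAbs < B := by
        rw [natAbs_iota]; have := i.isLt; omega
      have hmj' : B₃ ≤ (if j % 2 = 1 then (((j + 1) / 2 : ℕ) : ℤ) else -((j / 2 : ℕ) : ℤ)).natAbs := by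
        rw [natAbs_iota]; exact hmj
      have h := abs_sechBonus_signed_far_le_rw ha hB hBB hi hmj'
      rw [rowWeight_iota, natAbs_iota] at h
      rw [← sq_abs, ← mul_pow]
      refine pow_le_pow_left₀ (abs_nonneg _) (h.trans_eq ?_) 2
      simp only [hσ]
      ring
    have hsumsq : ∑ i : Fin (2 * B - 1), ((ite ((if (i : ℕ) % 2 = 1 then ((((i : ℕ) + 1) / 2 : ℕ) : ℤ) else -((((i : ℕ) / 2 : ℕ) : ℤ))) = (if j % 2 = 1 then (((j + 1) / 2 : ℕ) : ℤ) else -((j / 2 : ℕ) : ℤ))) π 0) - sechIncrCoeff a (if (i : ℕ) % 2 = 1 then ((((i : ℕ) + 1) / 2 : ℕ) : ℤ) else -((((i : ℕ) / 2 : ℕ) : ℤ))) (if j % 2 = 1 then (((j + 1) / 2 : ℕ) : ℤ) else -((j / 2 : ℕ) : ℤ))) ^ 2 ≤ R * σ ((j + 1) / 2) ^ 2 := by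
      refine (Finset.sum_le_sum fun i _ ↦ hentry i).trans ?_
      rw [← Finset.sum_mul]
    have hnum0 : 0 ≤ R * σ ((j + 1) / 2) ^ 2 * X := by positivity
    calc _ ≤ R * σ ((j + 1) / 2) ^ 2 * X / W ((j + 1) / 2) := by
          refine div_le_div_of_nonneg_right (hcs.trans ?_) hWpos.le
          exact mul_le_mul_of_nonneg_right hsumsq hX0
      _ ≤ _ := div_le_div_of_nonneg_left hnum0 hd₀ hWj
  -- sum over the far enumeration, both signs of the mode
  refine (Finset.sum_le_sum fun j hj ↦ hterm j (Finset.mem_Ico.mp hj).1).trans ?_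
  have hpair := sum_Ico_enum_le_two_sided (fun j ↦ R * σ ((j + 1) / 2) ^ 2 * X / d₀) hB₃1
    (fun j _ ↦ by positivity) N'
  refine hpair.trans ?_
  have e : ∀ m ∈ Finset.Ico B₃ (N' + 1),
      R * σ ((2 * m - 1 + 1) / 2) ^ 2 * X / d₀ + R * σ ((2 * m + 1) / 2) ^ 2 * X / d₀
        = (R * (2 * (a * c / π ^ 2) ^ 2) * X / d₀) * (1 / ((m - B + 1 : ℕ) : ℝ) ^ 2) := by
    intro m hm
    have hm1 : 1 ≤ m := le_trans hB₃1 (Finset.mem_Ico.mp hm).1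
    have e1 : (2 * m - 1 + 1) / 2 = m := by omega
    have e2 : (2 * m + 1) / 2 = m := by omega
    rw [e1, e2]
    simp only [hσ]
    ring
  rw [Finset.sum_congr rfl e, ← Finset.mul_sum]
  have hsum := sum_Ico_inv_sq_shift_le hB hBB (N' + 1)
  have hK0 : 0 ≤ R * (2 * (a * c / π ^ 2) ^ 2) * X / d₀ := by positivity
  calc _ ≤ R * (2 * (a * c / π ^ 2) ^ 2) * X / d₀ * (1 / ((B₃ - B : ℕ) : ℝ)) :=
        mul_le_mul_of_nonneg_left hsum hK0
    _ = _ := by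
        have hBB' : (0 : ℝ) < ((B₃ - B : ℕ) : ℝ) := by exact_mod_cast (show 0 < B₃ - B by omega)
        field_simp

end Bonus

end Summit.Ventures.WeilGRH

end
-- Build note (weil-grh-5 gen21, 2026-08-24): APPEND re-land of the module accepted as p366960 (2026-08-23T14:30:55Z) whose hub olean
-- was never produced; declarations above are byte-identical (lead R14-3 (1) append remedy). Importer: TwistedOddComplexDataRungJrw.
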